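import Summits.SmoothPoincare4.SmoothPoincare4.Theorems.ConvexBisectionAcyclicBisectionExistsDualHandlePushTubeInv
import HarnessLib

/-!
# Dual handles, XVI: the push of `X₁` as ONE self-diffeomorphism of Kosinski's tube
(brick (PUSH-h) = (ii-1) of the sub-goal T3b step (ii) "push the prefix sub-handlebody `X₁` off the
cocore neighbourhood `N` of the suffix handles" of stub `stub_steinRealisation` (NF6), line
`modp-braid-orbits` r11, crux `ConvexBisection.AcyclicBisectionExists`, item
stmt-SmoothPoincare4-10508; wave 3, lead c5, worker Z3)

The global push `sh : X₁ → X₁` is `h̄ⱼ ∘ S ∘ h̄ⱼ⁻¹` on the tube of the `j`-th attaching circle `γ`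
and the identity elsewhere; here is `S = selfPush κ δ` in tube coordinates (`s = ‖y_λ‖²`,
`α = handleInversion 2`): `S y = α (modelPush κ δ (α y))` for `s < 1 - 3κ²/8`, `S y = α (tubePush κ δ y)`
for `s ≥ 1 - 3κ²/8` (the two agree on `1 - κ²/2 ≤ s < 1`, `modelPush_handleInversion`), with the
explicit inverse `selfPushInv` (`α ∘ modelPushInv ∘ α` below `s = 1 - 7κ²/16`, `tubePushInv ∘ α` above).
`S` is smooth on the open `tubePushDom κ ⊇ {‖y‖ ≤ 1, y_λ ≠ 0} ∪ γ`, `S⁻¹` on the open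
`selfPushInvDom κ δ`, they are mutually inverse (`selfPushInv_selfPush`, `selfPush_selfPushInv`,
`mapsTo_selfPush`, `mapsTo_selfPushInv`), `S = id` for `s ≤ 1 - 3κ²/4` (`selfPush_of_le`), and
`α (S y) = modelPush κ δ (α y)` for `0 < s < 1` (`handleInversion_selfPush`).  Everything here is
proved; no named facts.

## References
* J. Milnor, *Lectures on the h-cobordism theorem* (1965), §3 (dual handles). [MilnorHCobordism1965]
* A. A. Kosinski, *Differential Manifolds* (1993), VI §6, (6.1). [Kosinski1993]
-/

noncomputable section

-- the prescribed namespace `Summit.<P>.<Sub>.…` duplicates `SmoothPoincare4` (P = Sub)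
set_option linter.dupNamespace false

open scoped Manifold ContDiff Topology

namespace Summit.SmoothPoincare4.SmoothPoincare4.Theorems.AcyclicBisectionExists.ModpBraidOrbits

open Set Function Metric
open Literature.Topology.FourManifolds Literature.Topology.FourManifolds.HandleAttachingMap

namespace PushModel

section Self

variable {κ δ : ℝ}

/-- **THE PUSH OF `X₁` IN THE TUBE** (see the module docstring). [cite: MilnorHCobordism1965, §3] -/
def selfPush (κ δ : ℝ) (y : EuclideanSpace ℝ (Fin 4)) : EuclideanSpace ℝ (Fin 4) :=
  if sOf y < 1 - 3 * κ ^ 2 / 8 then handleInversion 2 (modelPush κ δ (handleInversion 2 y))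
  else handleInversion 2 (tubePush κ δ y)

/-- **Its inverse.** [folklore] -/
def selfPushInv (κ δ : ℝ) (x : EuclideanSpace ℝ (Fin 4)) : EuclideanSpace ℝ (Fin 4) :=
  if sOf x < 1 - 7 * κ ^ 2 / 16 then handleInversion 2 (modelPushInv κ δ (handleInversion 2 x))
  else tubePushInv κ δ (handleInversion 2 x)

/-- The domain of the inverse. [folklore] -/
def selfPushInvDom (κ δ : ℝ) : Set (EuclideanSpace ℝ (Fin 4)) :=
  {x | 0 < sOf x ∧ sOf x < 1 ∧ ((sOf x < 1 - 3 * κ ^ 2 / 8 ∧ handleInversion 2 x ∈ pushInvDom κ δ) ∨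
    (1 - κ ^ 2 / 2 < sOf x ∧ handleInversion 2 x ∈ tubePushInvDom κ δ))}

/-- **Interior formula**: `S y = α (modelPush (α y))` for all `0 < s < 1`. [folklore] -/
theorem selfPush_eq_in (hκ : 0 < κ) (hκ2 : κ ≤ 1 / 2) (hδ : 0 < δ) {y : EuclideanSpace ℝ (Fin 4)}
    (h0 : 0 < sOf y) (h1 : sOf y < 1) :
    selfPush κ δ y = handleInversion 2 (modelPush κ δ (handleInversion 2 y)) := by
  unfold selfPush
  split_ifs with h
  · rfl
  · rw [modelPush_handleInversion hκ hκ2 hδ h0 h1 (by linarith [not_lt.1 h])]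

/-- **Formula near `γ`**: `S y = α (tubePush y)` for `1 - κ²/2 ≤ s` (`y ∈ tubePushDom`). [folklore] -/
theorem selfPush_eq_near (hκ : 0 < κ) (hκ2 : κ ≤ 1 / 2) (hδ : 0 < δ) {y : EuclideanSpace ℝ (Fin 4)}
    (hs : 1 - κ ^ 2 / 2 ≤ sOf y) (hy : y ∈ tubePushDom κ) : selfPush κ δ y = handleInversion 2 (tubePush κ δ y) := by
  unfold selfPush
  split_ifs with h
  · have hκsq : κ ^ 2 ≤ 1 / 4 := by nlinarith
    rw [modelPush_handleInversion hκ hκ2 hδ (sOf_pos_iff.2 hy.1) (by linarith) (by linarith)]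
  · rfl

/-- **`S = id` away from `γ`**: `s ≤ 1 - 3κ²/4`, `0 < s`. [folklore] -/
theorem selfPush_of_le (hκ : 0 < κ) (hκ2 : κ ≤ 1 / 2) (hδ : 0 < δ) {y : EuclideanSpace ℝ (Fin 4)}
    (h0 : 0 < sOf y) (h : sOf y ≤ 1 - 3 * κ ^ 2 / 4) : selfPush κ δ y = y := by
  have h1 : sOf y < 1 := by linarith [pow_pos hκ 2]
  rw [selfPush_eq_in hκ hκ2 hδ h0 h1, modelPush_of_ge hκ (by rw [sOf_handleInversion h0 h1.le]; linarith),
    handleInversion_handleInversion_sOf h0 h1]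

/-- **`α ∘ S = modelPush ∘ α` on `{0 < s < 1}`** (so `Ξ ∘ modelPush ∘ α = Ξ ∘ α ∘ S`). [folklore] -/
theorem handleInversion_selfPush (hκ : 0 < κ) (hκ2 : κ ≤ 1 / 2) (hδ : 0 < δ) {y : EuclideanSpace ℝ (Fin 4)}
    (h0 : 0 < sOf y) (h1 : sOf y < 1) :
    handleInversion 2 (selfPush κ δ y) = modelPush κ δ (handleInversion 2 y) := by
  obtain ⟨hP0, hP1, -⟩ := sOf_modelPush_handleInversion hκ hκ2 (δ := δ) h0 h1
  rw [selfPush_eq_in hκ hκ2 hδ h0 h1, handleInversion_handleInversion_sOf hP0 hP1]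

/-- **`S` is smooth on `tubePushDom κ`** (`⊇ {‖y‖ ≤ 1, y_λ ≠ 0} ∪ γ`). [folklore] -/
theorem contDiffOn_selfPush (hκ : 0 < κ) (hκ2 : κ ≤ 1 / 2) (hδ : 0 < δ) :
    ContDiffOn ℝ ∞ (selfPush κ δ) (tubePushDom κ) := by
  have hκsq : κ ^ 2 ≤ 1 / 4 := by nlinarith
  set O₁ : Set (EuclideanSpace ℝ (Fin 4)) := {y | 0 < sOf y ∧ sOf y < 1}
  have hO₁o : IsOpen O₁ := (isOpen_lt continuous_const contDiff_sOf.continuous).inter (isOpen_lt contDiff_sOf.continuous continuous_const)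
  set O₂ : Set (EuclideanSpace ℝ (Fin 4)) := tubePushDom κ ∩ {y | 1 - κ ^ 2 / 2 < sOf y}
  have hO₂o : IsOpen O₂ := (isOpen_tubePushDom hκ).inter (isOpen_lt continuous_const contDiff_sOf.continuous)
  have hF₁ : ContDiffOn ℝ ∞ (fun y => handleInversion 2 (modelPush κ δ (handleInversion 2 y))) O₁ := by
    refine contDiffOn_handleInversion_sOf.comp ((contDiffOn_modelPush hκ hκ2 hδ).comp
      contDiffOn_handleInversion_sOf fun y hy => ?_) fun y hy => ?_
    · exact sOf_pos_iff.1 (by rw [sOf_handleInversion hy.1 hy.2.le]; linarith [hy.2])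
    · exact let h := sOf_modelPush_handleInversion hκ hκ2 (δ := δ) hy.1 hy.2; ⟨h.1, h.2.1⟩
  have hF₂ : ContDiffOn ℝ ∞ (fun y => handleInversion 2 (tubePush κ δ y)) O₂ := by
    refine contDiffOn_handleInversion_sOf.comp ((contDiffOn_tubePush hκ δ).mono inter_subset_left) fun y hy => ?_
    refine ⟨by rw [sOf_tubePush hy.1]; exact hy.1.2, ?_⟩
    have h2 : 1 - κ ^ 2 / 2 < sOf y := hy.2
    rw [sOf_tubePush hy.1]
    linarith [(pushP_mem hκ (show 1 - sOf y < κ ^ 2 / 2 by linarith) (q := muN y / κ ^ 2)).2]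
  intro y hy
  have hs := sOf_pos_iff.2 hy.1
  rcases lt_or_ge (sOf y) 1 with h | h
  · have hmem : O₁ ∈ 𝓝 y := hO₁o.mem_nhds ⟨hs, h⟩
    refine ((hF₁.contDiffAt hmem).congr_of_eventuallyEq ?_).contDiffWithinAt
    filter_upwards [hmem] with z hz using selfPush_eq_in hκ hκ2 hδ hz.1 hz.2
  · have hmem : O₂ ∈ 𝓝 y := hO₂o.mem_nhds ⟨hy, by show 1 - κ ^ 2 / 2 < sOf y; linarith [pow_pos hκ 2]⟩
    refine ((hF₂.contDiffAt hmem).congr_of_eventuallyEq ?_).contDiffWithinAt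
    filter_upwards [hmem] with z hz using selfPush_eq_near hκ hκ2 hδ (le_of_lt hz.2) hz.1

/-- The domain of the inverse is open. [folklore] -/
theorem isOpen_selfPushInvDom (hκ : 0 < κ) (δ : ℝ) : IsOpen (selfPushInvDom κ δ) := by
  have hO : IsOpen {x : EuclideanSpace ℝ (Fin 4) | 0 < sOf x ∧ sOf x < 1} := (isOpen_lt continuous_const contDiff_sOf.continuous).inter (isOpen_lt contDiff_sOf.continuous continuous_const)
  have hc : ContinuousOn (handleInversion (m := 4) 2) {x | 0 < sOf x ∧ sOf x < 1} := contDiffOn_handleInversion_sOf.continuousOn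
  have h1 := hc.isOpen_inter_preimage hO (isOpen_pushInvDom hκ δ)
  have h2 := hc.isOpen_inter_preimage hO (isOpen_tubePushInvDom hκ δ)
  have hA : IsOpen {x : EuclideanSpace ℝ (Fin 4) | sOf x < 1 - 3 * κ ^ 2 / 8} := isOpen_lt contDiff_sOf.continuous continuous_const
  have hB : IsOpen {x : EuclideanSpace ℝ (Fin 4) | 1 - κ ^ 2 / 2 < sOf x} := isOpen_lt continuous_const contDiff_sOf.continuous
  convert (h1.inter hA).union (h2.inter hB) using 1
  ext x
  simp only [selfPushInvDom, mem_setOf_eq, mem_union, mem_inter_iff, mem_preimage]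
  tauto

/-- On the domain, with `z = α x`: `z ∈ tubePushInvDom`, `P z = 1 - s`, and `P₀ = pullP κ (P z) (Q z/δ) ≤ P z`.
[folklore] -/
theorem levels_of_mem_selfPushInvDom (hκ : 0 < κ) {x : EuclideanSpace ℝ (Fin 4)} (hx : x ∈ selfPushInvDom κ δ) :
    handleInversion 2 x ∈ tubePushInvDom κ δ ∧ sOf (handleInversion 2 x) = 1 - sOf x ∧
      pullP κ (sOf (handleInversion 2 x)) (muN (handleInversion 2 x) / δ) ≤ 1 - sOf x := by
  obtain ⟨h0, h1, h⟩ := hx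
  set z := handleInversion 2 x
  have hP : sOf z = 1 - sOf x := sOf_handleInversion h0 h1.le
  have hPpos : 0 < sOf z := by rw [hP]; linarith
  rcases h with ⟨-, hV⟩ | ⟨-, hW⟩
  · have hle : pullP κ (sOf z) (muN z / δ) ≤ sOf z := by
      conv_rhs => rw [← pushP_pullLevel hκ hV]
      exact le_pushP hκ _ _
    refine ⟨⟨?_, by linarith, hPpos⟩, hP, by rw [← hP]; exact hle⟩
    rcases lt_or_ge (sOf z) (κ ^ 2 / 2) with hl | hl
    · have := exp_lt_of_mem_pullDom hV hl
      exact mem_pullDomGe_of_exp_lt hl (by linarith [Real.one_lt_exp_iff.2 (show 0 < 2 / κ ^ 2 by positivity)])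
    · exact mem_pullDomGe_of_ge hl
  · have hpush : pushP κ (pullP κ (sOf z) (muN z / δ)) (muN z / δ) = sOf z :=
      pushP_pullP hκ fun h => exp_lt_of_mem_pullDomGe hW.1 h
    refine ⟨hW, hP, ?_⟩
    rw [← hP]
    conv_rhs => rw [← hpush]
    exact le_pushP hκ _ _

/-- … and if moreover `s < 1 - 3κ²/8` then `0 < P₀` and `z ∈ pushInvDom` (`P z > 3κ²/8 ≥ pushP κ 0 q`).
[folklore] -/
theorem pos_of_mem_selfPushInvDom (hκ : 0 < κ) (hδ : 0 < δ) {x : EuclideanSpace ℝ (Fin 4)}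
    (hx : x ∈ selfPushInvDom κ δ) (hθ : sOf x < 1 - 3 * κ ^ 2 / 8) :
    0 < pullP κ (sOf (handleInversion 2 x)) (muN (handleInversion 2 x) / δ) ∧ handleInversion 2 x ∈ pushInvDom κ δ := by
  obtain ⟨hW, hP, hle⟩ := levels_of_mem_selfPushInvDom hκ hx
  rcases hx.2.2 with ⟨-, hV⟩ | ⟨hs, -⟩
  · exact ⟨pullLevel_pos hκ hV, hV⟩
  set z := handleInversion 2 x
  set q := muN z / δ
  have hq0 : 0 ≤ q := div_nonneg (sq_nonneg _) hδ.le
  have hpush : pushP κ (pullP κ (sOf z) q) q = sOf z := pushP_pullP hκ fun h => exp_lt_of_mem_pullDomGe hW.1 h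
  have hlt : sOf z < κ ^ 2 / 2 := by rw [hP]; linarith
  have hκ0 := pow_pos hκ 2
  have hP₀ : 0 < pullP κ (sOf z) q := by
    by_contra hn
    have h1' : sOf z ≤ pushP κ 0 q := by rw [← hpush]; exact (pushP_strictMono hκ q).monotone (not_lt.1 hn)
    have h2' : pushP κ 0 q ≤ pushP κ (κ ^ 2 * q) q := (pushP_strictMono hκ q).monotone (by positivity)
    rw [pushP_base hκ q] at h2'
    rcases lt_or_ge q (1 / 4) with hq | hq
    · linarith [PushModel.pFun_le (κ := κ) q, mul_lt_mul_of_pos_left hq hκ0]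
    · linarith [pushP_of_shift_zero (κ := κ) (0 : ℝ) (pushShift_of_ge hq)]
  refine ⟨hP₀, ?_⟩
  show (sOf z, q) ∈ pullDom κ
  have := exp_lt_exp_pushP hκ hP₀ (lt_of_le_of_lt (by rw [← hP] at hle; exact hle) hlt) (q := q)
  rw [hpush] at this
  exact mem_pullDom_of_exp_lt hlt this

/-- The two formulas of `S⁻¹` agree where `0 < P₀ ≤ κ²/2`, `P z > 0` (`z = α x`). [folklore] -/
theorem selfPushInv_formulas_agree (hκ : 0 < κ) (hκ2 : κ ≤ 1 / 2) (hδ : 0 < δ) {z : EuclideanSpace ℝ (Fin 4)}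
    (hP : 0 < sOf z) (hP₀ : 0 < pullP κ (sOf z) (muN z / δ)) (hP₀2 : pullP κ (sOf z) (muN z / δ) ≤ κ ^ 2 / 2) :
    handleInversion 2 (modelPushInv κ δ z) = tubePushInv κ δ z := by
  have hκsq : κ ^ 2 ≤ 1 / 4 := by nlinarith
  set P₀ := pullP κ (sOf z) (muN z / δ) with hP₀d
  have hP₀1 : P₀ < 1 := by linarith
  have hg : muScaleSq κ δ P₀ = δ * P₀ / (κ ^ 2 * (1 - P₀)) := muScaleSq_of_le hκ hκ2 hP₀2
  have hgpos : 0 < muScaleSq κ δ P₀ := muScaleSq_pos hκ hκ2 hδ hP₀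
  have hs : sOf (modelPushInv κ δ z) = P₀ := by
    rw [sOf, modelPushInv, lamPart_torusScale, norm_sqrt_smul_sq (div_pos hP₀ hP).le, ← sOf, div_mul_cancel₀ _ hP.ne']
  rw [handleInversion_eq_torusScale, hs, modelPushInv, ← hP₀d, torusScale_torusScale, tubePushInv, ← hP₀d]
  have hA : 0 < Real.sqrt P₀ := Real.sqrt_pos.2 hP₀
  have hB : 0 < Real.sqrt (1 - P₀) := Real.sqrt_pos.2 (by linarith)
  congr 1
  · rw [Real.sqrt_div' _ hP.le, Real.sqrt_div' _ hP.le, div_mul_div_comm, mul_comm (Real.sqrt P₀) (Real.sqrt (sOf z)),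
      mul_div_mul_right _ _ hA.ne']
  · rw [hg, show δ * P₀ / (κ ^ 2 * (1 - P₀)) = (δ / κ ^ 2) * (P₀ / (1 - P₀)) by field_simp,
      Real.sqrt_mul (by positivity), Real.sqrt_div' _ (sq_nonneg κ), Real.sqrt_sq hκ.le,
      Real.sqrt_div' _ (by linarith : (0 : ℝ) ≤ 1 - P₀), mul_inv, div_mul_eq_mul_div, inv_div, inv_div]
    field_simp

/-- `S⁻¹ = α ∘ modelPushInv ∘ α` on the domain wherever that is the active formula OR `P₀ ≤ κ²/2`.
[folklore] -/
theorem selfPushInv_eq (hκ : 0 < κ) (hκ2 : κ ≤ 1 / 2) (hδ : 0 < δ) {x : EuclideanSpace ℝ (Fin 4)}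
    (hx : x ∈ selfPushInvDom κ δ) (h : 1 - κ ^ 2 / 2 < sOf x) :
    selfPushInv κ δ x = tubePushInv κ δ (handleInversion 2 x) := by
  unfold selfPushInv
  split_ifs with hlt
  · obtain ⟨-, hP, hle⟩ := levels_of_mem_selfPushInvDom hκ hx
    have hP₀ := (pos_of_mem_selfPushInvDom hκ hδ hx (by linarith [pow_pos hκ 2])).1
    exact selfPushInv_formulas_agree hκ hκ2 hδ (by rw [hP]; linarith [hx.2.1]) hP₀ (by linarith)
  · rfl

/-- **`S⁻¹` is smooth on its domain.** [folklore] -/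
theorem contDiffOn_selfPushInv (hκ : 0 < κ) (hκ2 : κ ≤ 1 / 2) (hδ : 0 < δ) :
    ContDiffOn ℝ ∞ (selfPushInv κ δ) (selfPushInvDom κ δ) := by
  have hκsq : κ ^ 2 ≤ 1 / 4 := by nlinarith
  set O : Set (EuclideanSpace ℝ (Fin 4)) := {x | 0 < sOf x ∧ sOf x < 1}
  set W₁ : Set (EuclideanSpace ℝ (Fin 4)) := {x | 0 < sOf x ∧ sOf x < 1 ∧ sOf x < 1 - 3 * κ ^ 2 / 8 ∧
    handleInversion 2 x ∈ pushInvDom κ δ}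
  set W₂ : Set (EuclideanSpace ℝ (Fin 4)) := {x | 0 < sOf x ∧ sOf x < 1 ∧ 1 - κ ^ 2 / 2 < sOf x ∧
    handleInversion 2 x ∈ tubePushInvDom κ δ}
  have hW₁ : W₁ ⊆ selfPushInvDom κ δ := fun x hx => ⟨hx.1, hx.2.1, Or.inl hx.2.2⟩
  have hW₂ : W₂ ⊆ selfPushInvDom κ δ := fun x hx => ⟨hx.1, hx.2.1, Or.inr hx.2.2⟩
  have hO : IsOpen O := (isOpen_lt continuous_const contDiff_sOf.continuous).inter (isOpen_lt contDiff_sOf.continuous continuous_const)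
  have hc : ContinuousOn (handleInversion (m := 4) 2) O := contDiffOn_handleInversion_sOf.continuousOn
  have hA : IsOpen {x : EuclideanSpace ℝ (Fin 4) | sOf x < 1 - 3 * κ ^ 2 / 8} := isOpen_lt contDiff_sOf.continuous continuous_const
  have hB : IsOpen {x : EuclideanSpace ℝ (Fin 4) | 1 - κ ^ 2 / 2 < sOf x} := isOpen_lt continuous_const contDiff_sOf.continuous
  have hW₁o : IsOpen W₁ := by
    convert (hc.isOpen_inter_preimage hO (isOpen_pushInvDom hκ δ)).inter hA using 1
    ext x; simp only [W₁, O, mem_setOf_eq, mem_inter_iff, mem_preimage]; tauto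
  have hW₂o : IsOpen W₂ := by
    convert (hc.isOpen_inter_preimage hO (isOpen_tubePushInvDom hκ δ)).inter hB using 1
    ext x; simp only [W₂, O, mem_setOf_eq, mem_inter_iff, mem_preimage]; tauto
  have hG₁ : ContDiffOn ℝ ∞ (fun x => handleInversion 2 (modelPushInv κ δ (handleInversion 2 x))) W₁ := by
    refine contDiffOn_handleInversion_sOf.comp (((contDiffOn_modelPushInv hκ hκ2 hδ).comp
      (contDiffOn_handleInversion_sOf.mono fun x hx => ⟨hx.1, hx.2.1⟩) fun x hx => hx.2.2.2)) fun x hx => ?_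
    obtain ⟨-, hP, hle⟩ := levels_of_mem_selfPushInvDom hκ (hW₁ hx)
    obtain ⟨hP₀, hV⟩ := pos_of_mem_selfPushInvDom hκ hδ (hW₁ hx) hx.2.2.1
    refine ⟨by rw [sOf_modelPushInv hκ hV]; exact hP₀, by rw [sOf_modelPushInv hκ hV]; linarith [hx.1]⟩
  have hG₂ : ContDiffOn ℝ ∞ (fun x => tubePushInv κ δ (handleInversion 2 x)) W₂ :=
    (contDiffOn_tubePushInv hκ δ).comp (contDiffOn_handleInversion_sOf.mono fun x hx => ⟨hx.1, hx.2.1⟩)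
      fun x hx => hx.2.2.2
  intro x hx
  rcases hx.2.2 with ⟨hs, hV⟩ | ⟨hs, hW⟩
  · have hmem : W₁ ∈ 𝓝 x := hW₁o.mem_nhds ⟨hx.1, hx.2.1, hs, hV⟩
    refine ((hG₁.contDiffAt hmem).congr_of_eventuallyEq ?_).contDiffWithinAt
    filter_upwards [hmem] with z hz
    unfold selfPushInv
    split_ifs with hlt
    · rfl
    · obtain ⟨-, hP, hle⟩ := levels_of_mem_selfPushInvDom hκ (hW₁ hz)
      have hP₀ := (pos_of_mem_selfPushInvDom hκ hδ (hW₁ hz) hz.2.2.1).1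
      exact (selfPushInv_formulas_agree hκ hκ2 hδ (by rw [hP]; linarith [hz.2.1]) hP₀ (by linarith [not_lt.1 hlt])).symm
  · have hmem : W₂ ∈ 𝓝 x := hW₂o.mem_nhds ⟨hx.1, hx.2.1, hs, hW⟩
    refine ((hG₂.contDiffAt hmem).congr_of_eventuallyEq ?_).contDiffWithinAt
    filter_upwards [hmem] with z hz using selfPushInv_eq hκ hκ2 hδ (hW₂ hz) hz.2.2.1

/-- **`S⁻¹ ∘ S = id` on `tubePushDom`.** [folklore] -/
theorem selfPushInv_selfPush (hκ : 0 < κ) (hκ2 : κ ≤ 1 / 2) (hδ : 0 < δ) {y : EuclideanSpace ℝ (Fin 4)}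
    (hy : y ∈ tubePushDom κ) : selfPushInv κ δ (selfPush κ δ y) = y := by
  have hκsq : κ ^ 2 ≤ 1 / 4 := by nlinarith
  have hs := sOf_pos_iff.2 hy.1
  unfold selfPushInv
  split_ifs with hlt
  · have h1 : sOf y < 1 := by
      by_contra h
      have h' : 1 ≤ sOf y := not_lt.1 h
      rw [selfPush_eq_near hκ hκ2 hδ (by linarith [pow_pos hκ 2]) hy, sOf_handleInversion] at hlt
      · rw [sOf_tubePush hy] at hlt
        have : pushP κ (1 - sOf y) (muN y / κ ^ 2) ≤ pushP κ 0 (muN y / κ ^ 2) :=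
          (pushP_strictMono hκ _).monotone (by linarith)
        have h2 : pushP κ 0 (muN y / κ ^ 2) ≤ pFun κ (muN y / κ ^ 2) := by
          rw [← pushP_base hκ]
          exact (pushP_strictMono hκ _).monotone (mul_nonneg (sq_nonneg κ) (div_nonneg (sq_nonneg _) (sq_nonneg κ)))
        have hκ0 := pow_pos hκ 2
        rcases lt_or_ge (muN y / κ ^ 2) (1 / 4) with hq | hq
        · linarith [PushModel.pFun_le (κ := κ) (muN y / κ ^ 2), mul_lt_mul_of_pos_left hq hκ0]
        · linarith [pushP_of_shift_zero (κ := κ) (0 : ℝ) (pushShift_of_ge hq)]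
      · rw [sOf_tubePush hy]; exact hy.2
      · rw [sOf_tubePush hy]
        linarith [(pushP_mem hκ (show 1 - sOf y < κ ^ 2 / 2 by linarith [pow_pos hκ 2]) (q := muN y / κ ^ 2)).2]
    obtain ⟨hP0, hP1, -⟩ := sOf_modelPush_handleInversion hκ hκ2 (δ := δ) hs h1
    have hx : lamPart (handleInversion 2 y) ≠ 0 := sOf_pos_iff.1 (by rw [sOf_handleInversion hs h1.le]; linarith)
    rw [selfPush_eq_in hκ hκ2 hδ hs h1, handleInversion_handleInversion_sOf hP0 hP1,
      modelPushInv_modelPush hκ hκ2 hδ hx, handleInversion_handleInversion_sOf hs h1]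
  · have h1 : 1 - κ ^ 2 / 2 < sOf y := by
      by_contra h
      have h' : sOf y ≤ 1 - κ ^ 2 / 2 := not_lt.1 h
      have h1' : sOf y < 1 := by linarith [pow_pos hκ 2]
      obtain ⟨hP0, hP1, -⟩ := sOf_modelPush_handleInversion hκ hκ2 (δ := δ) hs h1'
      rw [selfPush_eq_in hκ hκ2 hδ hs h1', sOf_handleInversion hP0 hP1.le,
        sOf_modelPush hκ (sOf_pos_iff.1 (by rw [sOf_handleInversion hs h1'.le]; linarith)),
        sOf_handleInversion hs h1'.le, pushP_of_ge _ (by linarith)] at hlt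
      linarith [pow_pos hκ 2]
    have hP' := sOf_tubePush hy (δ := δ)
    have hP'1 : sOf (tubePush κ δ y) < 1 := by
      rw [hP']; linarith [(pushP_mem hκ (show 1 - sOf y < κ ^ 2 / 2 by linarith) (q := muN y / κ ^ 2)).2]
    rw [selfPush_eq_near hκ hκ2 hδ h1.le hy, handleInversion_handleInversion_sOf (by rw [hP']; exact hy.2) hP'1,
      tubePushInv_tubePush hκ hδ hy]

/-- **`S` maps `tubePushDom` into `selfPushInvDom`.** [folklore] -/
theorem mapsTo_selfPush (hκ : 0 < κ) (hκ2 : κ ≤ 1 / 2) (hδ : 0 < δ) :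
    MapsTo (selfPush κ δ) (tubePushDom κ) (selfPushInvDom κ δ) := by
  intro y hy
  have hκsq : κ ^ 2 ≤ 1 / 4 := by nlinarith
  have hs := sOf_pos_iff.2 hy.1
  rcases le_or_gt (sOf y) (1 - κ ^ 2 / 2) with h | h
  · have h1 : sOf y < 1 := by linarith [pow_pos hκ 2]
    have hx : lamPart (handleInversion 2 y) ≠ 0 := sOf_pos_iff.1 (by rw [sOf_handleInversion hs h1.le]; linarith)
    obtain ⟨hP0, hP1, -⟩ := sOf_modelPush_handleInversion hκ hκ2 (δ := δ) hs h1
    have hge : κ ^ 2 / 2 ≤ sOf (modelPush κ δ (handleInversion 2 y)) := by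
      rw [sOf_modelPush hκ hx, sOf_handleInversion hs h1.le]
      exact le_trans (by linarith) (le_pushP hκ _ _)
    rw [selfPush_eq_in hκ hκ2 hδ hs h1]
    refine ⟨by rw [sOf_handleInversion hP0 hP1.le]; linarith, by rw [sOf_handleInversion hP0 hP1.le]; linarith,
      Or.inl ⟨by rw [sOf_handleInversion hP0 hP1.le]; linarith [pow_pos hκ 2], ?_⟩⟩
    rw [handleInversion_handleInversion_sOf hP0 hP1]
    exact mapsTo_modelPush hκ hκ2 hδ hx
  · have hP' := sOf_tubePush hy (δ := δ)
    have hlt : sOf (tubePush κ δ y) < κ ^ 2 / 2 := by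
      rw [hP']; exact (pushP_mem hκ (show 1 - sOf y < κ ^ 2 / 2 by linarith) (q := muN y / κ ^ 2)).2
    have hP'0 : 0 < sOf (tubePush κ δ y) := by rw [hP']; exact hy.2
    have hP'1 : sOf (tubePush κ δ y) < 1 := by linarith
    rw [selfPush_eq_near hκ hκ2 hδ h.le hy]
    refine ⟨by rw [sOf_handleInversion hP'0 hP'1.le]; linarith, by rw [sOf_handleInversion hP'0 hP'1.le]; linarith,
      Or.inr ⟨by rw [sOf_handleInversion hP'0 hP'1.le]; linarith, ?_⟩⟩
    rw [handleInversion_handleInversion_sOf hP'0 hP'1]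
    exact mapsTo_tubePush hκ hδ hy

/-- **`S ∘ S⁻¹ = id` on `selfPushInvDom`.** [folklore] -/
theorem selfPush_selfPushInv (hκ : 0 < κ) (hκ2 : κ ≤ 1 / 2) (hδ : 0 < δ) {x : EuclideanSpace ℝ (Fin 4)}
    (hx : x ∈ selfPushInvDom κ δ) : selfPush κ δ (selfPushInv κ δ x) = x := by
  have hκsq : κ ^ 2 ≤ 1 / 4 := by nlinarith
  obtain ⟨hW, hP, hle⟩ := levels_of_mem_selfPushInvDom hκ hx
  set z := handleInversion 2 x with hz
  have hzz : handleInversion 2 z = x := handleInversion_handleInversion_sOf hx.1 hx.2.1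
  unfold selfPushInv
  split_ifs with hlt
  · obtain ⟨hP₀, hV⟩ := pos_of_mem_selfPushInvDom hκ hδ hx (by linarith [pow_pos hκ 2])
    have hsy : sOf (modelPushInv κ δ z) = pullP κ (sOf z) (muN z / δ) := sOf_modelPushInv hκ hV
    have hy0 : 0 < sOf (modelPushInv κ δ z) := by rw [hsy]; exact hP₀
    have hy1 : sOf (modelPushInv κ δ z) < 1 := by rw [hsy]; linarith [hx.1]
    have hw0 : 0 < sOf (handleInversion 2 (modelPushInv κ δ z)) := by rw [sOf_handleInversion hy0 hy1.le]; linarith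
    have hw1 : sOf (handleInversion 2 (modelPushInv κ δ z)) < 1 := by rw [sOf_handleInversion hy0 hy1.le]; linarith
    rw [← hz, selfPush_eq_in hκ hκ2 hδ hw0 hw1, handleInversion_handleInversion_sOf hy0 hy1,
      modelPush_modelPushInv hκ hκ2 hδ hV, hzz]
  · have hs : 1 - 7 * κ ^ 2 / 16 ≤ sOf x := not_lt.1 hlt
    have hy : tubePushInv κ δ z ∈ tubePushDom κ := mapsTo_tubePushInv hκ hδ hW
    have hsy : sOf (tubePushInv κ δ z) = 1 - pullP κ (sOf z) (muN z / δ) := sOf_tubePushInv hW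
    rw [← hz, selfPush_eq_near hκ hκ2 hδ (by rw [hsy]; linarith [pow_pos hκ 2]) hy, tubePush_tubePushInv hκ hδ hW, hzz]

/-- **`S⁻¹` maps `selfPushInvDom` into `tubePushDom`.** [folklore] -/
theorem mapsTo_selfPushInv (hκ : 0 < κ) (hδ : 0 < δ) :
    MapsTo (selfPushInv κ δ) (selfPushInvDom κ δ) (tubePushDom κ) := by
  intro x hx
  obtain ⟨hW, hP, hle⟩ := levels_of_mem_selfPushInvDom hκ hx
  unfold selfPushInv
  split_ifs with hlt
  · obtain ⟨hP₀, hV⟩ := pos_of_mem_selfPushInvDom hκ hδ hx (by linarith [pow_pos hκ 2])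
    have hsy : sOf (modelPushInv κ δ (handleInversion 2 x)) = _ := sOf_modelPushInv hκ hV
    have hy0 : 0 < sOf (modelPushInv κ δ (handleInversion 2 x)) := by rw [hsy]; exact hP₀
    have hy1 : sOf (modelPushInv κ δ (handleInversion 2 x)) < 1 := by rw [hsy]; linarith [hx.1]
    have hw : sOf (handleInversion 2 (modelPushInv κ δ (handleInversion 2 x))) = _ := sOf_handleInversion hy0 hy1.le
    refine ⟨sOf_pos_iff.1 (by rw [hw]; linarith), ?_⟩
    rw [hw, sub_sub_cancel]
    exact lt_of_lt_of_le hy0 (le_pushP hκ _ _)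
  · exact mapsTo_tubePushInv hκ hδ hW

end Self

end PushModel

/-- **Registered helper `helper_selfPush_diffeo` (brick (PUSH-h) = (ii-1) of T3b (ii), sub-goal of NF6
`stub_steinRealisation`, wave 3, lead c5): the push of `X₁` in Kosinski's tube is ONE map
`selfPush κ δ`, smooth on the open set `tubePushDom κ` (containing the punctured closed ball and the
attaching circle `γ`), with smooth inverse `selfPushInv κ δ` on the open set `selfPushInvDom κ δ`,
the identity for `‖y_λ‖² ≤ 1 - 3κ²/4`, and conjugate by `α` to `modelPush κ δ` on `{0 < ‖y_λ‖² < 1}`.**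
[folklore] -/
theorem helper_selfPush_diffeo : ∀ {κ δ : ℝ}, 0 < κ → κ ≤ 1 / 2 → 0 < δ → IsOpen (Summit.SmoothPoincare4.SmoothPoincare4.Theorems.AcyclicBisectionExists.ModpBraidOrbits.PushModel.selfPushInvDom κ δ) ∧ ContDiffOn ℝ ∞ (Summit.SmoothPoincare4.SmoothPoincare4.Theorems.AcyclicBisectionExists.ModpBraidOrbits.PushModel.selfPush κ δ) (Summit.SmoothPoincare4.SmoothPoincare4.Theorems.AcyclicBisectionExists.ModpBraidOrbits.PushModel.tubePushDom κ) ∧ ContDiffOn ℝ ∞ (Summit.SmoothPoincare4.SmoothPoincare4.Theorems.AcyclicBisectionExists.ModpBraidOrbits.PushModel.selfPushInv κ δ) (Summit.SmoothPoincare4.SmoothPoincare4.Theorems.AcyclicBisectionExists.ModpBraidOrbits.PushModel.selfPushInvDom κ δ) ∧ Set.MapsTo (Summit.SmoothPoincare4.SmoothPoincare4.Theorems.AcyclicBisectionExists.ModpBraidOrbits.PushModel.selfPush κ δ) (Summit.SmoothPoincare4.SmoothPoincare4.Theorems.AcyclicBisectionExists.ModpBraidOrbits.PushModel.tubePushDom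 κ) (Summit.SmoothPoincare4.SmoothPoincare4.Theorems.AcyclicBisectionExists.ModpBraidOrbits.PushModel.selfPushInvDom κ δ) ∧ Set.MapsTo (Summit.SmoothPoincare4.SmoothPoincare4.Theorems.AcyclicBisectionExists.ModpBraidOrbits.PushModel.selfPushInv κ δ) (Summit.SmoothPoincare4.SmoothPoincare4.Theorems.AcyclicBisectionExists.ModpBraidOrbits.PushModel.selfPushInvDom κ δ) (Summit.SmoothPoincare4.SmoothPoincare4.Theorems.AcyclicBisectionExists.ModpBraidOrbits.PushModel.tubePushDom κ) ∧ (∀ y ∈ Summit.SmoothPoincare4.SmoothPoincare4.Theorems.AcyclicBisectionExists.ModpBraidOrbits.PushModel.tubePushDom κ, Summit.SmoothPoincare4.SmoothPoincare4.Theorems.AcyclicBisectionExists.ModpBraidOrbits.PushModel.selfPushInv κ δ (Summit.SmoothPoincare4.SmoothPoincare4.Theorems.AcyclicBisectionExists.ModpBraidOrbits.PushModel.selfPush κ δ y) = y) ∧ (∀ x ∈ Summit.SmoothPoincare4.SmoothPoincare4.Theorems.AcyclicBisectionExists.ModpBraidOrbits.PushModel.selfPushInvDom κ δ, Summit.SmoothPoincare4.SmoothPoincare4.Theorems.AcyclicBisectionExists.ModpBraidOrbits.PushModel.selfPush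 κ δ (Summit.SmoothPoincare4.SmoothPoincare4.Theorems.AcyclicBisectionExists.ModpBraidOrbits.PushModel.selfPushInv κ δ x) = x) ∧ (∀ y : EuclideanSpace ℝ (Fin 4), 0 < ‖Literature.Topology.FourManifolds.lamPart y‖ ^ 2 → ‖Literature.Topology.FourManifolds.lamPart y‖ ^ 2 ≤ 1 - 3 * κ ^ 2 / 4 → Summit.SmoothPoincare4.SmoothPoincare4.Theorems.AcyclicBisectionExists.ModpBraidOrbits.PushModel.selfPush κ δ y = y) ∧ (∀ y : EuclideanSpace ℝ (Fin 4), 0 < ‖Literature.Topology.FourManifolds.lamPart y‖ ^ 2 → ‖Literature.Topology.FourManifolds.lamPart y‖ ^ 2 < 1 → Literature.Topology.FourManifolds.handleInversion 2 (Summit.SmoothPoincare4.SmoothPoincare4.Theorems.AcyclicBisectionExists.ModpBraidOrbits.PushModel.selfPush κ δ y) = Summit.SmoothPoincare4.SmoothPoincare4.Theorems.AcyclicBisectionExists.ModpBraidOrbits.PushModel.modelPush κ δ (Literature.Topology.FourManifolds.handleInversion 2 y)) := by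
  intro κ δ hκ hκ2 hδ
  exact ⟨PushModel.isOpen_selfPushInvDom hκ δ, PushModel.contDiffOn_selfPush hκ hκ2 hδ,
    PushModel.contDiffOn_selfPushInv hκ hκ2 hδ, PushModel.mapsTo_selfPush hκ hκ2 hδ, PushModel.mapsTo_selfPushInv hκ hδ,
    fun y hy => PushModel.selfPushInv_selfPush hκ hκ2 hδ hy, fun x hx => PushModel.selfPush_selfPushInv hκ hκ2 hδ hx,
    fun y h0 h1 => PushModel.selfPush_of_le hκ hκ2 hδ h0 h1, fun y h0 h1 => PushModel.handleInversion_selfPush hκ hκ2 hδ h0 h1⟩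

end Summit.SmoothPoincare4.SmoothPoincare4.Theorems.AcyclicBisectionExists.ModpBraidOrbits

end
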